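import Summits.Parity.GeneralizedHardyLittlewood.Theorems.BeyondDiagonalBeatsQuarter.OffDiagCoreWinLevels
import HarnessLib

/-!
# Route `PrimeLevelFamEdge`, crux K_B (stmt-Parity-20343), line `diagonal_kernel_split` rev 4, plan Ω,
# node **L7d part 2, leaf G1 — the windowed FL-family as ONE finite sum over a member index set**
# (L7D-PLAN rev 7 §7 G1; consumer of S₁ `coreWin_largeKernel_eq_levelLargePart`)

The family large sieve (F2b `norm_sum_family_levelFactor_le`) takes ONE `Finset` of members. The 8-fold nest of S₁ — cells
`(r,l,m,d₁,d₂,i)` at the block top `Q`, dual moduli `h₁ ∈ [−H*, H*]`, shifts `s ∈ [−Sf, Sf]` — is a chain of `Finset.sigma`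
(each range may depend on all outer indices), and `Finset.sum_sigma` unfolds it back:

* `memberSet G Q N Hf T Δ′ : Finset MemberIdx` (`MemberIdx = Σ r, Σ l, Σ m, Σ d₁, Σ d₂, Σ i, Σ h₁, s`), accessors `MemberIdx.r … .s`;
* **`coreWin_largeKernel_eq_sum_memberSet`** — `coreWin (D·K_L) T G Q N Hf Δ′ = −re Σ_{x ∈ memberSet} 𝟙[cop x]·
  levelLargePart R G (q ↦ 𝟙[window_x q]·coreLevelWeight D Hf Δ′ x q) (switchMod (r+1) s h₁) (switchClass (r+1) ab s h₁)`;
* `mem_memberSet` — membership unfolds to the eight range conditions.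

Bookkeeping only; standard axioms. Helper toward `stub_offDiagBelowSlack_io`; closes nothing.
«The programme SEARCHES and TYPES; no claim about Landau–Siegel zeros, Theorems 1–2 of arXiv:2211.02515 or
a repaired Margin232 until a kernel theorem says so.»
-/

noncomputable section

open Finset Real Polynomial

namespace Summit.Parity.GeneralizedHardyLittlewood.Theorems.BeyondDiagonalBeatsQuarter.OffDiag

open Literature.NumberTheory.LFunctions Literature.NumberTheory.LFunctions.KMV2000
open Literature.NumberTheory.Sieve.FriedlanderIwaniecPrimes (fourier2)
open PeterssonSplit (nearBoxes)

/-- The member index type of the windowed family: `(r, l, m, d₁, d₂, i, h₁, s)` as a right-nested sigma type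
(so that every range may depend on the outer indices). [folklore] -/
abbrev MemberIdx : Type := Σ _ : ℕ, Σ _ : ℕ, Σ _ : ℕ, Σ _ : ℕ, Σ _ : ℕ, Σ _ : ℕ × ℕ, Σ _ : ℤ, ℤ

namespace MemberIdx

/-- Petersson layer `r`. -/
abbrev r (x : MemberIdx) : ℕ := x.1
/-- Mollifier index `l`. -/
abbrev l (x : MemberIdx) : ℕ := x.2.1
/-- Mollifier index `m`. -/
abbrev m (x : MemberIdx) : ℕ := x.2.2.1
/-- Divisor `d₁ ∣ l`. -/
abbrev d₁ (x : MemberIdx) : ℕ := x.2.2.2.1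
/-- Divisor `d₂ ∣ m`. -/
abbrev d₂ (x : MemberIdx) : ℕ := x.2.2.2.2.1
/-- Dyadic box `i`. -/
abbrev i (x : MemberIdx) : ℕ × ℕ := x.2.2.2.2.2.1
/-- Dual modulus `h₁`. -/
abbrev h₁ (x : MemberIdx) : ℤ := x.2.2.2.2.2.2.1
/-- Switched shift `s`. -/
abbrev s (x : MemberIdx) : ℤ := x.2.2.2.2.2.2.2

end MemberIdx

/-- **The member index set of the windowed family** at the block top `Q`, reference level `N`, heights `Hf`, window `T`:
cells of the nest, `h₁ ∈ [−H*, H*]` (`H* = sup_G Hf`), `s ∈ [−Sf, Sf]` (`Sf = T + ⌈|ab/(N(r+1))|⌉₊`).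
[cite: KowalskiMichelVanderKam2000, §6 p. 19 — derivation (bookkeeping)] -/
def memberSet (G : Finset ℕ) (Q N : ℕ) (Hf : ℕ → ℕ → ℕ → ℕ → ℕ → ℕ → ℕ × ℕ → ℕ)
    (T : ℕ → ℕ → ℕ → ℕ → ℕ → ℕ × ℕ → ℤ → ℕ) (Δ' : ℝ) : Finset MemberIdx :=
  (Finset.range (Q ^ 7)).sigma fun r ↦ (Finset.Icc 1 ⌊qhat Q ^ Δ'⌋₊).sigma fun l ↦
    (Finset.Icc 1 ⌊qhat Q ^ Δ'⌋₊).sigma fun m ↦ l.divisors.sigma fun d₁ ↦ m.divisors.sigma fun d₂ ↦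
      (nearBoxes Q d₁ d₂ (Real.log Q ^ 4)).sigma fun i ↦
        (Icc (-((G.sup (fun q ↦ Hf q d₁ d₂ (l / d₁) (m / d₂) (r + 1) i) : ℕ) : ℤ))
          ((G.sup (fun q ↦ Hf q d₁ d₂ (l / d₁) (m / d₂) (r + 1) i) : ℕ) : ℤ)).sigma fun h₁ ↦
          Icc (-((T r l m d₁ d₂ i h₁ + ⌈|((((l / d₁ : ℕ) : ℤ) * (m / d₂ : ℕ) : ℤ) : ℝ) / ((N : ℝ) * ((r + 1 : ℕ) : ℝ))|⌉₊ : ℕ) : ℤ))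
            ((T r l m d₁ d₂ i h₁ + ⌈|((((l / d₁ : ℕ) : ℤ) * (m / d₂ : ℕ) : ℤ) : ℝ) / ((N : ℝ) * ((r + 1 : ℕ) : ℝ))|⌉₊ : ℕ) : ℤ)

/-- Membership in `memberSet` is the eight range conditions. [folklore] -/
theorem mem_memberSet {G : Finset ℕ} {Q N : ℕ} {Hf : ℕ → ℕ → ℕ → ℕ → ℕ → ℕ → ℕ × ℕ → ℕ}
    {T : ℕ → ℕ → ℕ → ℕ → ℕ → ℕ × ℕ → ℤ → ℕ} {Δ' : ℝ} {x : MemberIdx} (hx : x ∈ memberSet G Q N Hf T Δ') :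
    x.r ∈ Finset.range (Q ^ 7) ∧ x.l ∈ Finset.Icc 1 ⌊qhat Q ^ Δ'⌋₊ ∧ x.m ∈ Finset.Icc 1 ⌊qhat Q ^ Δ'⌋₊ ∧
      x.d₁ ∈ x.l.divisors ∧ x.d₂ ∈ x.m.divisors ∧ x.i ∈ nearBoxes Q x.d₁ x.d₂ (Real.log Q ^ 4) ∧
      x.h₁ ∈ Icc (-((G.sup (fun q ↦ Hf q x.d₁ x.d₂ (x.l / x.d₁) (x.m / x.d₂) (x.r + 1) x.i) : ℕ) : ℤ))
        ((G.sup (fun q ↦ Hf q x.d₁ x.d₂ (x.l / x.d₁) (x.m / x.d₂) (x.r + 1) x.i) : ℕ) : ℤ) ∧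
      x.s ∈ Icc (-((T x.r x.l x.m x.d₁ x.d₂ x.i x.h₁ +
          ⌈|((((x.l / x.d₁ : ℕ) : ℤ) * (x.m / x.d₂ : ℕ) : ℤ) : ℝ) / ((N : ℝ) * ((x.r + 1 : ℕ) : ℝ))|⌉₊ : ℕ) : ℤ))
        ((T x.r x.l x.m x.d₁ x.d₂ x.i x.h₁ +
          ⌈|((((x.l / x.d₁ : ℕ) : ℤ) * (x.m / x.d₂ : ℕ) : ℤ) : ℝ) / ((N : ℝ) * ((x.r + 1 : ℕ) : ℝ))|⌉₊ : ℕ) : ℤ) := by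
  obtain ⟨r, l, m, d₁, d₂, i, h₁, s⟩ := x
  simp only [memberSet, Finset.mem_sigma] at hx
  exact hx

/-- Pushing a level-free indicator through two inner sums. [folklore] -/
theorem ite_sum_sum_eq {α β : Type*} (p : Prop) [Decidable p] (A : Finset α) (B : α → Finset β) (f : α → β → ℂ) :
    (if p then ∑ a ∈ A, ∑ b ∈ B a, f a b else 0) = ∑ a ∈ A, ∑ b ∈ B a, (if p then f a b else 0) := by
  split_ifs <;> simp

open Classical in
/-- **The windowed FL-family as ONE finite sum over `memberSet`.** For any `R`, selector `D`, window `T`, levels `G`, `Q`,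
`N`, `Hf`, `Δ′`:
`coreWin (D·K_L) T G Q N Hf Δ′ = −re Σ_{x ∈ memberSet G Q N Hf T Δ′} 𝟙[(l/d₁, r+1) = 1]·
   levelLargePart R G (q ↦ 𝟙[window_x q]·coreLevelWeight D Hf Δ′ x q) (switchMod (r+1) s h₁) (switchClass (r+1) ab s h₁)`.
[cite: KowalskiMichelVanderKam2000, §6 p. 19 — derivation; Davenport1980, ch. 29 — derivation] -/
theorem coreWin_largeKernel_eq_sum_memberSet (R : ℕ) (D : ℕ → ℕ → ℕ → ℕ → ℕ → ℕ × ℕ → ℤ → ℤ → ℂ)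
    (T : ℕ → ℕ → ℕ → ℕ → ℕ → ℕ × ℕ → ℤ → ℕ) (G : Finset ℕ) (Q N : ℕ)
    (Hf : ℕ → ℕ → ℕ → ℕ → ℕ → ℕ → ℕ × ℕ → ℕ) (Δ' : ℝ) :
    coreWin (fun q r l m d₁ d₂ i h₁ s ↦ D r l m d₁ d₂ i h₁ s *
        levelLargePart R {q} (fun _ ↦ (1 : ℂ)) (switchMod (r + 1) s h₁)
          (switchClass (r + 1) (((l / d₁ : ℕ) : ℤ) * (m / d₂ : ℕ)) s h₁)) T G Q N Hf Δ' =
      -((∑ x ∈ memberSet G Q N Hf T Δ',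
          if Nat.Coprime (x.l / x.d₁) (x.r + 1) then
            levelLargePart R G (fun q ↦ if (T x.r x.l x.m x.d₁ x.d₂ x.i x.h₁ : ℝ) <
                  |(x.s : ℝ) + ((((x.l / x.d₁ : ℕ) : ℤ) * (x.m / x.d₂ : ℕ) : ℤ) : ℝ) / ((q * (x.r + 1) : ℕ) : ℝ)| then 0 else
                coreLevelWeight D Hf Δ' x.r x.l x.m x.d₁ x.d₂ x.i x.h₁ x.s q)
              (switchMod (x.r + 1) x.s x.h₁) (switchClass (x.r + 1) (((x.l / x.d₁ : ℕ) : ℤ) * (x.m / x.d₂ : ℕ)) x.s x.h₁)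
          else 0).re) := by
  rw [coreWin_largeKernel_eq_levelLargePart]
  refine neg_re_congr ?_
  simp only [memberSet, Finset.sum_sigma, MemberIdx.r, MemberIdx.l, MemberIdx.m, MemberIdx.d₁, MemberIdx.d₂, MemberIdx.i,
    MemberIdx.h₁, MemberIdx.s]
  refine Finset.sum_congr rfl fun r _ ↦ Finset.sum_congr rfl fun l _ ↦ Finset.sum_congr rfl fun m _ ↦
    Finset.sum_congr rfl fun d₁ _ ↦ Finset.sum_congr rfl fun d₂ _ ↦ Finset.sum_congr rfl fun i _ ↦ ?_
  rw [ite_sum_sum_eq]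

end Summit.Parity.GeneralizedHardyLittlewood.Theorems.BeyondDiagonalBeatsQuarter.OffDiag
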